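/-
Copyright: fleet lead `ym-wcr-19609-p1` (seat prover-ym-wcr-19609-p1-g0-0), route `WeakCouplingRates`, crux
`BulkDominatesColdBoxW` (stmt-QuantumFields-19609), line `dlr-chessboard` (skeleton sha16 021c654069d76526).
-/
import Summits.QuantumFields.YangMills.Theorems.WeakCouplingRatesBulkDominatesColdBoxWDlrPlumbing
import Literature.MathematicalPhysics.QuantumFieldTheory.CloverStressTensor

/-!
# Registered stub L3 `stub_dlrAssembly : DlrAssembly` of crux `BulkDominatesColdBoxW` (stmt-QuantumFields-19609), BY NAME —
# part 2 of 2: the torus covariance through the box kernels and the DLR assembly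

WHAT.  `DlrAssembly` (module `WeakCouplingRatesBulkDominatesColdBoxWDefs`, the line's L3, registered signature `DlrAssembly`):
for all real `A θ δ η₁ K` with `0 < A`, `0 < δ`, `0 < η₁` and the window `K + 4δ + 2A < 2 + 2θ`,
`GoodBoundaryCovStable A θ δ η₁ → GoodBoundaryMeanSmooth A θ δ → PlaquetteLargeFieldRarity δ → BoxPolyFloor A θ K →
BulkDominatesBox (G := SU(2)) (fundamentalRep (Fin 2)) A θ`.  PROVED here (`stub_dlrAssembly`) with `η = η₁/2`:

* `torusPlaqCov_eq_boxKernel` — for torus sides `L+1 > 2(2H+T+2)` the leaf's origin-based torus covariance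
  `torusPlaqCov ρ β L T 1 2` equals `∫ q − ∫ h · ∫ k` with `h, k, q` the box-kernel (`ymSpecification ρ β (boxEdges 4 (2H+1)) ·`)
  means of `c_p`, `c_{p'}`, `c_p c_{p'}` (`p = (boxCentre H; 1,2)`, `p' = p + Te₀`) at the periodic lift: translation invariance
  of the torus state (`integral_comp_configShift_torusLift`) + the DLR equations (`wilsonExpectation_toTorusObservable_eq`, with
  the torus fit `fst_mem_box_of_mem_boxUnion` of part 1);
* `boxPlaqCov_le` — `boxPlaqCov ≤ 32`;
* `stub_dlrAssembly` — part 1's abstract law of total covariance (`total_covariance_lower_bound_sub`, constant `K₀ = 4`) with the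
  exceptional event `{lift ∈ bad set}` (mass `≤ 6(2H+3)⁴e^{−β^δ}` by L2, `measureReal_badSet_le`; off it the datum is `CrudeGood`, so
  L1a gives `q − hk ≥ η₁·boxPlaqCov` and L1b gives `|k − h| ≤ |K₁| β^{2δ−1} T/H`), then the window arithmetic
  `ε²/4 ≤ K₁² β^{4δ−2+2A−2θ} ≤ ¼η₁β^{−K}` and `(η₁X + 48)·6(2H+3)⁴e^{−β^δ} ≤ ¼η₁β^{−K}` for `β ≥ β₀`, and `β^{−K} ≤ X = boxPlaqCov`
  (`BoxPolyFloor`): `Cov_torus ≥ η₁X − ¼η₁X − ¼η₁X = (η₁/2)X`, eventually in `L`.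

WHAT THIS IS NOT.  No analysis: L1a, L1b and `BoxPolyFloor` (= BOX_W + FLOOR) are hypotheses of `DlrAssembly`.  NOT a claim about
the mass gap.

References: H.-O. Georgii, *Gibbs Measures and Phase Transitions* (2011) Prop. 2.5, Thm. 4.17; S. Friedli, Y. Velenik (2017) Lemma 6.7,
(6.34); E. Seiler, LNP 159 (1982) Ch. 2; R. Durrett (2019) §4.1.
-/

set_option autoImplicit false

noncomputable section

open MeasureTheory Filter Topology
open Literature.MathematicalPhysics
open Literature.MathematicalPhysics.QuantumFieldTheory
open Literature.MathematicalPhysics.QuantumLattice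
open Literature.Probability.LatticeModels (Torus.proj box mem_box)

namespace Summit.QuantumFields.YangMills.Theorems.WeakCouplingRates

/-! ### §5. The torus covariance through the box kernels (translation invariance + the DLR equations) -/

/-- **The torus two-point function through the box kernels.** For the torus of side `L+1 > 2(2H+T+2)`, the leaf's
origin-based torus covariance `torusPlaqCov ρ β L T 1 2` equals `∫ q − ∫ h · ∫ k`, where `h, k, q` are the box-kernel
(`ymSpecification ρ β (boxEdges 4 (2H+1)) ·`) means of `c_p`, `c_{p'}`, `c_p c_{p'}` (`p = (boxCentre H; 1,2)`, `p' = p + Te₀`)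
evaluated at the periodic lift of the torus configuration: translation invariance of the torus state moves the pair to the box
centre, and the DLR equations (`wilsonExpectation_toTorusObservable_eq`, injectivity of the projection on `[−M,M]⁴`) insert the
kernel (Georgii 2011 Thm. 4.17; Friedli–Velenik 2017 Lemma 6.7). [folklore] -/
theorem torusPlaqCov_eq_boxKernel (β : ℝ) {H T L : ℕ} (hL : 2 * (2 * H + T + 2) < L + 1) :
    torusPlaqCov (d := 4) (G := (Matrix.specialUnitaryGroup (Fin 2) ℂ)) (fundamentalRep (Fin 2)) β L T 1 2 =
      (∫ U, (∫ W, plaqCostAt (fundamentalRep (Fin 2)) (boxCentre H) 1 2 W *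
              plaqCostAt (fundamentalRep (Fin 2)) (boxCentre H + Pi.single 0 (T : ℤ)) 1 2 W
            ∂(ymSpecification (d := 4) (fundamentalRep (Fin 2)) β (AxialGauge.boxEdges 4 (2 * H + 1)) (torusLift (L + 1) U)))
          ∂(wilsonMeasure (d := 4) (L := L + 1) (fundamentalRep (Fin 2)) β)) -
        (∫ U, (∫ W, plaqCostAt (fundamentalRep (Fin 2)) (boxCentre H) 1 2 W
            ∂(ymSpecification (d := 4) (fundamentalRep (Fin 2)) β (AxialGauge.boxEdges 4 (2 * H + 1)) (torusLift (L + 1) U)))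
          ∂(wilsonMeasure (d := 4) (L := L + 1) (fundamentalRep (Fin 2)) β)) *
        (∫ U, (∫ W, plaqCostAt (fundamentalRep (Fin 2)) (boxCentre H + Pi.single 0 (T : ℤ)) 1 2 W
            ∂(ymSpecification (d := 4) (fundamentalRep (Fin 2)) β (AxialGauge.boxEdges 4 (2 * H + 1)) (torusLift (L + 1) U)))
          ∂(wilsonMeasure (d := 4) (L := L + 1) (fundamentalRep (Fin 2)) β)) := by
  haveI : SecondCountableTopology (Matrix.specialUnitaryGroup (Fin 2) ℂ) := secondCountableTopology_su2
  set ρ := fundamentalRep (Fin 2) with hρdef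
  have hρc : Continuous ρ := continuous_fundamentalRep (Fin 2)
  set bc : Literature.Probability.LatticeModels.Site 4 := boxCentre H with hbc
  set v0 : Literature.Probability.LatticeModels.Site 4 := Pi.single 0 (T : ℤ) with hv0
  set Λ : Finset (QuantumLattice.ZdEdge 4) := AxialGauge.boxEdges 4 (2 * H + 1) with hΛ
  set cp : LGConfig 4 (Matrix.specialUnitaryGroup (Fin 2) ℂ) → ℝ := plaqCostAt ρ bc 1 2 with hcp
  set cp' : LGConfig 4 (Matrix.specialUnitaryGroup (Fin 2) ℂ) → ℝ := plaqCostAt ρ (bc + v0) 1 2 with hcp'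
  -- supports and the torus fit
  set S₀ : Finset (QuantumLattice.ZdEdge 4) :=
    plaquetteEdges ((bc, ⟨(1, 2), by decide⟩) : ZdPlaquette 4) ∪
      plaquetteEdges ((bc + v0, ⟨(1, 2), by decide⟩) : ZdPlaquette 4) with hS₀
  have hcyl : IsCylinder cp S₀ := (isCylinder_plaqCostAt12 bc).mono (Finset.coe_subset.2 Finset.subset_union_left)
  have hcyl' : IsCylinder cp' S₀ := (isCylinder_plaqCostAt12 (bc + v0)).mono (Finset.coe_subset.2 Finset.subset_union_right)
  have hcylq : IsCylinder (fun U => cp U * cp' U) S₀ := by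
    exact IsCylinder.mul (isCylinder_plaqCostAt12 bc) (isCylinder_plaqCostAt12 (bc + v0))
  have hinj : Set.InjOn (Torus.proj (L + 1))
      ((Λ ∪ S₀ ∪ (plaquettesTouching Λ).biUnion plaquetteEdges).image Prod.fst :
        Set (Literature.Probability.LatticeModels.Site 4)) := by
    intro x hx y hy hxy
    obtain ⟨e, he, rfl⟩ := Finset.mem_image.1 (Finset.mem_coe.1 hx)
    obtain ⟨e', he', rfl⟩ := Finset.mem_image.1 (Finset.mem_coe.1 hy)
    exact Literature.Probability.LatticeModels.torusProj_injOn_box hL (fst_mem_box_of_mem_boxUnion he)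
      (fst_mem_box_of_mem_boxUnion he') hxy
  -- the DLR equations for the three observables
  have hcpc : Continuous cp := continuous_plaqCostAt bc 1 2
  have hcpc' : Continuous cp' := continuous_plaqCostAt (bc + v0) 1 2
  have hcpK : ∀ U, |cp U| ≤ 4 := abs_plaqCostAt_le bc 1 2
  have hcpK' : ∀ U, |cp' U| ≤ 4 := abs_plaqCostAt_le (bc + v0) 1 2
  have hqc : Continuous fun U => cp U * cp' U := hcpc.mul hcpc'
  have hqK : ∀ U, |cp U * cp' U| ≤ 4 ^ 2 := abs_plaqCostAt_mul_le bc (bc + v0) 1 2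
  have dlr : ∀ {F : LGConfig 4 (Matrix.specialUnitaryGroup (Fin 2) ℂ) → ℝ}, Continuous F → ∀ {C : ℝ}, (∀ U, |F U| ≤ C) → IsCylinder F S₀ →
      ∫ U, F (torusLift (L + 1) U) ∂(wilsonMeasure (d := 4) (L := L + 1) ρ β) = ∫ U, (∫ W, F W ∂(ymSpecification ρ β Λ (torusLift (L + 1) U))) ∂(wilsonMeasure (d := 4) (L := L + 1) ρ β) := by
    intro F hF C hC hFS
    have h := wilsonExpectation_toTorusObservable_eq ρ hρc β Λ hF hC hFS (L := L + 1) hinj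
    simpa only [wilsonExpectation, toTorusObservable, Function.comp_def] using h
  -- translation of the origin-based pair to the box centre
  have hpt1 : ∀ W : LGConfig 4 (Matrix.specialUnitaryGroup (Fin 2) ℂ), cp (configShift bc W) = plaqCost0 ρ 1 2 W := fun W => by
    simp only [hcp, plaqCostAt, plaqCost0, plaquetteObs, plaquetteHolonomyZd_configShift, sub_self]
  have hpt2 : ∀ W : LGConfig 4 (Matrix.specialUnitaryGroup (Fin 2) ℂ), cp' (configShift bc W) = plaqCost0 ρ 1 2 (timeShiftLG T W) := fun W => by
    simp only [hcp', plaqCostAt, plaqCost0, plaquetteObs, timeShiftLG, plaquetteHolonomyZd_configShift, hv0,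
      add_sub_cancel_left, sub_neg_eq_add, zero_add]
  have e1 : ∫ U, plaqCost0 ρ 1 2 (torusLift (L + 1) U) * plaqCost0 ρ 1 2 (timeShiftLG T (torusLift (L + 1) U)) ∂(wilsonMeasure (d := 4) (L := L + 1) ρ β) =
      ∫ U, (∫ W, cp W * cp' W ∂(ymSpecification ρ β Λ (torusLift (L + 1) U))) ∂(wilsonMeasure (d := 4) (L := L + 1) ρ β) := by
    rw [← dlr hqc hqK hcylq, ← integral_comp_configShift_torusLift (S := L + 1) ρ β (fun U => cp U * cp' U) bc]
    simp only [hpt1, hpt2]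
  have e2 : ∫ U, plaqCost0 ρ 1 2 (torusLift (L + 1) U) ∂(wilsonMeasure (d := 4) (L := L + 1) ρ β) = ∫ U, (∫ W, cp W ∂(ymSpecification ρ β Λ (torusLift (L + 1) U))) ∂(wilsonMeasure (d := 4) (L := L + 1) ρ β) := by
    rw [← dlr hcpc hcpK hcyl, ← integral_comp_configShift_torusLift (S := L + 1) ρ β cp bc]
    simp only [hpt1]
  have e3 : ∫ U, plaqCost0 ρ 1 2 (timeShiftLG T (torusLift (L + 1) U)) ∂(wilsonMeasure (d := 4) (L := L + 1) ρ β) =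
      ∫ U, (∫ W, cp' W ∂(ymSpecification ρ β Λ (torusLift (L + 1) U))) ∂(wilsonMeasure (d := 4) (L := L + 1) ρ β) := by
    rw [← dlr hcpc' hcpK' hcyl', ← integral_comp_configShift_torusLift (S := L + 1) ρ β cp' bc]
    simp only [hpt2]
  unfold torusPlaqCov wilsonExpectation
  simp only [toTorusObservable_apply]
  rw [e1, e2, e3]


/-! ### §6. The registered stub L3 -/

/-- A bound on the cold-wall box covariance: `boxPlaqCov ρ β H T ≤ 32` (`|c| ≤ 4`). [folklore] -/
theorem boxPlaqCov_le (β : ℝ) (H T : ℕ) : boxPlaqCov (G := (Matrix.specialUnitaryGroup (Fin 2) ℂ)) (fundamentalRep (Fin 2)) β H T ≤ 32 := by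
  haveI : SecondCountableTopology (Matrix.specialUnitaryGroup (Fin 2) ℂ) := secondCountableTopology_su2
  have hρc : Continuous (fundamentalRep (Fin 2) : (Matrix.specialUnitaryGroup (Fin 2) ℂ) →* _) := continuous_fundamentalRep (Fin 2)
  have i1 := abs_integral_ymSpecification_le (fundamentalRep (Fin 2)) hρc β (AxialGauge.boxEdges 4 (2 * H + 1))
    (abs_plaqCostAt_mul_le (boxCentre H) (boxCentre H + Pi.single 0 (T : ℤ)) 1 2) (fun _ => 1)
  have i2 := abs_integral_ymSpecification_le (fundamentalRep (Fin 2)) hρc β (AxialGauge.boxEdges 4 (2 * H + 1))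
    (abs_plaqCostAt_le (boxCentre H) 1 2) (fun _ => 1)
  have i3 := abs_integral_ymSpecification_le (fundamentalRep (Fin 2)) hρc β (AxialGauge.boxEdges 4 (2 * H + 1))
    (abs_plaqCostAt_le (boxCentre H + Pi.single 0 (T : ℤ)) 1 2) (fun _ => 1)
  rw [abs_le] at i1 i2 i3
  unfold boxPlaqCov boxState
  nlinarith [i1.2, i2.1, i2.2, i3.1, i3.2]

/-- **Registered stub `stub_dlrAssembly` of crux `stmt-QuantumFields-19609` (BULK_W)** — L3 of the DLR–chessboard line, by name and
signature: the DLR law of total covariance with a crude-good/bad split of the boundary datum turns L1a (`GoodBoundaryCovStable`),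
L1b (`GoodBoundaryMeanSmooth`), L2 (`PlaquetteLargeFieldRarity`) and the polynomial box floor (`BoxPolyFloor`) into
`BulkDominatesBox A θ` with `η = η₁/2`, on the window `K + 4δ + 2A < 2 + 2θ` (Georgii 2011 Thm. 4.17; Durrett 2019 §4.1). [folklore] -/
theorem stub_dlrAssembly : DlrAssembly := by
  intro A θ δ η₁ K hA hδ hη₁ hwin h1a h1b h2 hK
  obtain ⟨β₁, h1a⟩ := h1a
  obtain ⟨K₁, β₂, h1b⟩ := h1b
  obtain ⟨β₃, h2⟩ := h2
  obtain ⟨β₄, hK⟩ := hK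
  set ρ : (Matrix.specialUnitaryGroup (Fin 2) ℂ) →* Matrix (Fin 2) (Fin 2) ℂ := fundamentalRep (Fin 2) with hρdef
  have hρc : Continuous ρ := continuous_fundamentalRep (Fin 2)
  -- the window gap and the two asymptotic thresholds
  set g : ℝ := 2 + 2 * θ - K - 4 * δ - 2 * A with hg
  have hg0 : 0 < g := by rw [hg]; linarith
  have hA1ev : ∀ᶠ β : ℝ in atTop, 4 * K₁ ^ 2 * β ^ (-g) < η₁ := by
    have ht : Tendsto (fun β : ℝ => 4 * K₁ ^ 2 * β ^ (-g)) atTop (𝓝 (4 * K₁ ^ 2 * 0)) :=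
      (tendsto_rpow_neg_atTop hg0).const_mul _
    rw [mul_zero] at ht
    exact ht.eventually (gt_mem_nhds hη₁)
  set Cbad : ℝ := (32 * η₁ + 48) * (6 * 2401) with hCbad
  have hA2ev : ∀ᶠ β : ℝ in atTop, Cbad * (β ^ (4 * |θ| + K) * Real.exp (-(β ^ δ))) < η₁ / 4 := by
    have ht := (tendsto_rpow_mul_exp_neg_rpow (4 * |θ| + K) hδ).const_mul Cbad
    rw [mul_zero] at ht
    exact ht.eventually (gt_mem_nhds (by positivity))
  obtain ⟨β₅, hβ₅⟩ := Filter.eventually_atTop.1 (hA1ev.and hA2ev)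
  refine ⟨η₁ / 2, by positivity, max (max (max β₁ β₂) (max β₃ β₄)) (max β₅ 1), fun β hβ => ?_⟩
  simp only [max_le_iff] at hβ
  obtain ⟨⟨⟨hb1, hb2⟩, hb3, hb4⟩, hb5, hb6⟩ := hβ
  have hβ0 : 0 < β := by linarith
  obtain ⟨hA1, hA2⟩ := hβ₅ β hb5
  set H : ℕ := ⌈β ^ θ⌉₊ with hH
  set T : ℕ := ⌈β ^ A⌉₊ with hT
  -- sizes of `H` and `T`
  have hT2 : (T : ℝ) ≤ 2 * β ^ A := (one_le_ceil_rpow_and_le hb6 hA.le).2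
  have hθpos : 0 < β ^ θ := Real.rpow_pos_of_pos hβ0 θ
  have hHge : β ^ θ ≤ (H : ℝ) := Nat.le_ceil _
  have hHpos : (0 : ℝ) < H := lt_of_lt_of_le hθpos hHge
  have hHle : (H : ℝ) ≤ β ^ |θ| + 1 := by
    have h1 : (H : ℝ) < β ^ θ + 1 := Nat.ceil_lt_add_one hθpos.le
    have h2 : β ^ θ ≤ β ^ |θ| := Real.rpow_le_rpow_of_exponent_le hb6 (le_abs_self θ)
    linarith
  have habs1 : (1 : ℝ) ≤ β ^ |θ| := Real.one_le_rpow hb6 (abs_nonneg θ)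
  -- the box floor and the size of the box covariance
  have hXK : β ^ (-K) ≤ boxPlaqCov ρ β H T := hK β hb4
  have hXpos : 0 < boxPlaqCov ρ β H T := lt_of_lt_of_le (Real.rpow_pos_of_pos hβ0 _) hXK
  have hX32 : boxPlaqCov ρ β H T ≤ 32 := boxPlaqCov_le β H T
  -- eventually in the torus size
  filter_upwards [h2 β hb3, eventually_gt_atTop (2 * (2 * H + T + 2))] with L hL2 hLbig
  haveI : SecondCountableTopology (Matrix.specialUnitaryGroup (Fin 2) ℂ) := secondCountableTopology_su2
  haveI := isProbabilityMeasure_wilsonMeasure (d := 4) (L := L + 1) (G := (Matrix.specialUnitaryGroup (Fin 2) ℂ)) ρ hρc β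
  rw [torusPlaqCov_eq_boxKernel β (Nat.lt_succ_of_lt hLbig)]
  -- the kernel quantities
  set Λ : Finset (QuantumLattice.ZdEdge 4) := AxialGauge.boxEdges 4 (2 * H + 1) with hΛ
  set bc : Literature.Probability.LatticeModels.Site 4 := boxCentre H with hbc
  set v0 : Literature.Probability.LatticeModels.Site 4 := Pi.single 0 (T : ℤ) with hv0
  set cp : LGConfig 4 (Matrix.specialUnitaryGroup (Fin 2) ℂ) → ℝ := plaqCostAt ρ bc 1 2 with hcp
  set cp' : LGConfig 4 (Matrix.specialUnitaryGroup (Fin 2) ℂ) → ℝ := plaqCostAt ρ (bc + v0) 1 2 with hcp'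
  set h : GaugeConfig 4 (L + 1) (Matrix.specialUnitaryGroup (Fin 2) ℂ) → ℝ :=
    fun U => ∫ W, cp W ∂(ymSpecification ρ β Λ (torusLift (L + 1) U)) with hh
  set k : GaugeConfig 4 (L + 1) (Matrix.specialUnitaryGroup (Fin 2) ℂ) → ℝ :=
    fun U => ∫ W, cp' W ∂(ymSpecification ρ β Λ (torusLift (L + 1) U)) with hk
  set q : GaugeConfig 4 (L + 1) (Matrix.specialUnitaryGroup (Fin 2) ℂ) → ℝ :=
    fun U => ∫ W, cp W * cp' W ∂(ymSpecification ρ β Λ (torusLift (L + 1) U)) with hq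
  have hcpc : Continuous cp := continuous_plaqCostAt bc 1 2
  have hcpc' : Continuous cp' := continuous_plaqCostAt (bc + v0) 1 2
  have hcpK : ∀ U, |cp U| ≤ 4 := abs_plaqCostAt_le bc 1 2
  have hcpK' : ∀ U, |cp' U| ≤ 4 := abs_plaqCostAt_le (bc + v0) 1 2
  have hqc : Continuous fun U => cp U * cp' U := hcpc.mul hcpc'
  have hqK : ∀ U, |cp U * cp' U| ≤ 4 ^ 2 := abs_plaqCostAt_mul_le bc (bc + v0) 1 2
  have hml := measurable_torusLift (d := 4) (G := (Matrix.specialUnitaryGroup (Fin 2) ℂ)) (L + 1)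
  have hhm : Measurable h := (continuous_integral_ymSpecification ρ hρc β Λ hcpc hcpK).measurable.comp hml
  have hkm : Measurable k := (continuous_integral_ymSpecification ρ hρc β Λ hcpc' hcpK').measurable.comp hml
  have hqm : Measurable q := (continuous_integral_ymSpecification ρ hρc β Λ hqc hqK).measurable.comp hml
  have hhK : ∀ U, |h U| ≤ 4 := fun U => abs_integral_ymSpecification_le ρ hρc β Λ hcpK _
  have hkK : ∀ U, |k U| ≤ 4 := fun U => abs_integral_ymSpecification_le ρ hρc β Λ hcpK' _
  have hqK' : ∀ U, |q U| ≤ 4 ^ 2 := fun U => abs_integral_ymSpecification_le ρ hρc β Λ hqK _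
  -- the bad event and its mass
  set E : Set (GaugeConfig 4 (L + 1) (Matrix.specialUnitaryGroup (Fin 2) ℂ)) := {U | torusLift (L + 1) U ∈
      ⋃ z ∈ (Fintype.piFinset fun _ : Fin 4 => Finset.Icc (-1 : ℤ) (2 * (H : ℤ) + 1)) ×ˢ
          ((Finset.univ : Finset (Fin 4 × Fin 4)).filter fun q => q.1 < q.2),
        {W : LGConfig 4 (Matrix.specialUnitaryGroup (Fin 2) ℂ) | β ^ (2 * δ - 1) < plaqCostAt (fundamentalRep (Fin 2)) z.1 z.2.1 z.2.2 W}} with hE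
  have hEm : MeasurableSet E := hml (measurableSet_badSet β δ H)
  have hgood : ∀ U, U ∉ E → CrudeGood β δ H (torusLift (L + 1) U) := fun U hU => crudeGood_of_not_mem_badSet hU
  set p : ℝ := ((6 * (2 * H + 3) ^ 4 : ℕ) : ℝ) * Real.exp (-(β ^ δ)) with hp
  have hμE : (wilsonMeasure (d := 4) (L := L + 1) ρ β).real E ≤ p := measureReal_badSet_le hL2
  -- the conditional covariance (L1a) and the mean difference (L1b) off the bad event
  set X : ℝ := boxPlaqCov ρ β H T with hXdef
  have hθl : 0 ≤ η₁ * X := by positivity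
  set ε : ℝ := |K₁| * β ^ (2 * δ - 1) * T / H with hε
  have hlow : ∀ U, U ∉ E → η₁ * X ≤ q U - h U * k U := fun U hU => h1a β hb1 _ (hgood U hU)
  have hdiff : ∀ U, U ∉ E → |k U - h U| ≤ ε := fun U hU => by
    have h0 := h1b β hb2 _ (hgood U hU)
    refine h0.trans ?_
    rw [hε]
    have hnum : 0 ≤ β ^ (2 * δ - 1) * T / H := by positivity
    have e1 : K₁ * β ^ (2 * δ - 1) * ↑T / ↑H = K₁ * (β ^ (2 * δ - 1) * T / H) := by ring
    have e2 : |K₁| * β ^ (2 * δ - 1) * ↑T / ↑H = |K₁| * (β ^ (2 * δ - 1) * T / H) := by ring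
    rw [e1, e2]
    exact mul_le_mul_of_nonneg_right (le_abs_self K₁) hnum
  have key := total_covariance_lower_bound_sub hEm hhm hkm hqm hhK hkK hqK' hθl hlow hdiff hμE
  -- window arithmetic: the `ε²/4` term
  have hεX : ε ^ 2 / 4 ≤ η₁ / 4 * X := by
    have hε0 : 0 ≤ ε := by rw [hε]; positivity
    have hεle : ε ≤ 2 * |K₁| * β ^ (2 * δ - 1 + A - θ) := by
      calc ε = |K₁| * β ^ (2 * δ - 1) * T / H := hε
        _ ≤ |K₁| * β ^ (2 * δ - 1) * (2 * β ^ A) / β ^ θ := by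
            have hnum : |K₁| * β ^ (2 * δ - 1) * ↑T ≤ |K₁| * β ^ (2 * δ - 1) * (2 * β ^ A) :=
              mul_le_mul_of_nonneg_left hT2 (by positivity)
            calc |K₁| * β ^ (2 * δ - 1) * ↑T / ↑H ≤ |K₁| * β ^ (2 * δ - 1) * ↑T / β ^ θ :=
                  div_le_div_of_nonneg_left (by positivity) hθpos hHge
              _ ≤ |K₁| * β ^ (2 * δ - 1) * (2 * β ^ A) / β ^ θ := div_le_div_of_nonneg_right hnum hθpos.le
        _ = 2 * |K₁| * β ^ (2 * δ - 1 + A - θ) := by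
            rw [Real.rpow_sub hβ0 (2 * δ - 1 + A) θ, Real.rpow_add hβ0 (2 * δ - 1) A]
            field_simp
    have hsq : ε ^ 2 ≤ (2 * |K₁| * β ^ (2 * δ - 1 + A - θ)) ^ 2 := pow_le_pow_left₀ hε0 hεle 2
    have hexp : (2 * |K₁| * β ^ (2 * δ - 1 + A - θ)) ^ 2 = 4 * K₁ ^ 2 * β ^ (-g) * β ^ (-K) := by
      have e2 : (β ^ (2 * δ - 1 + A - θ)) ^ 2 = β ^ (-g) * β ^ (-K) := by
        rw [← Real.rpow_natCast (β ^ (2 * δ - 1 + A - θ)) 2, ← Real.rpow_mul hβ0.le, ← Real.rpow_add hβ0]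
        congr 1
        rw [hg]; push_cast; ring
      calc (2 * |K₁| * β ^ (2 * δ - 1 + A - θ)) ^ 2 = 4 * |K₁| ^ 2 * (β ^ (2 * δ - 1 + A - θ)) ^ 2 := by ring
        _ = 4 * K₁ ^ 2 * (β ^ (-g) * β ^ (-K)) := by rw [sq_abs, e2]
        _ = 4 * K₁ ^ 2 * β ^ (-g) * β ^ (-K) := by ring
    have h3 : 4 * K₁ ^ 2 * β ^ (-g) * β ^ (-K) ≤ η₁ * β ^ (-K) :=
      mul_le_mul_of_nonneg_right hA1.le (Real.rpow_nonneg hβ0.le _)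
    have h4 : η₁ * β ^ (-K) ≤ η₁ * X := mul_le_mul_of_nonneg_left hXK hη₁.le
    linarith
  -- window arithmetic: the bad-event term
  have hpX : (η₁ * X + 3 * 4 ^ 2) * p ≤ η₁ / 4 * X := by
    have hp0 : 0 ≤ p := by positivity
    have hcoef : η₁ * X + 3 * 4 ^ 2 ≤ 32 * η₁ + 48 := by nlinarith
    have hH4 : ((6 * (2 * H + 3) ^ 4 : ℕ) : ℝ) ≤ 6 * 2401 * β ^ (4 * |θ|) := by
      have h7 : (2 * (H : ℝ) + 3) ≤ 7 * β ^ |θ| := by linarith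
      have h74 : (2 * (H : ℝ) + 3) ^ 4 ≤ (7 * β ^ |θ|) ^ 4 := pow_le_pow_left₀ (by positivity) h7 4
      have e4 : (β ^ |θ|) ^ 4 = β ^ (4 * |θ|) := by
        rw [← Real.rpow_natCast (β ^ |θ|) 4, ← Real.rpow_mul hβ0.le]; norm_num; ring_nf
      push_cast
      rw [mul_pow, e4] at h74
      linarith
    have hsplit : β ^ (4 * |θ|) = β ^ (4 * |θ| + K) * β ^ (-K) := by
      rw [← Real.rpow_add hβ0]; ring_nf
    calc (η₁ * X + 3 * 4 ^ 2) * p ≤ (32 * η₁ + 48) * p := mul_le_mul_of_nonneg_right hcoef hp0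
      _ ≤ (32 * η₁ + 48) * (6 * 2401 * β ^ (4 * |θ|) * Real.exp (-(β ^ δ))) := by
          refine mul_le_mul_of_nonneg_left ?_ (by positivity)
          exact mul_le_mul_of_nonneg_right hH4 (Real.exp_pos _).le
      _ = Cbad * (β ^ (4 * |θ| + K) * Real.exp (-(β ^ δ))) * β ^ (-K) := by rw [hsplit, hCbad]; ring
      _ ≤ η₁ / 4 * β ^ (-K) := mul_le_mul_of_nonneg_right hA2.le (Real.rpow_nonneg hβ0.le _)
      _ ≤ η₁ / 4 * X := mul_le_mul_of_nonneg_left hXK (by positivity)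
  -- conclusion
  have hgoal : η₁ / 2 * X ≤ (∫ U, q U ∂(wilsonMeasure (d := 4) (L := L + 1) ρ β)) -
      (∫ U, h U ∂(wilsonMeasure (d := 4) (L := L + 1) ρ β)) * ∫ U, k U ∂(wilsonMeasure (d := 4) (L := L + 1) ρ β) := by
    linarith
  exact hgoal


end Summit.QuantumFields.YangMills.Theorems.WeakCouplingRates
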